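import Mathlib
import Summits.RiemannHypothesis.RiemannHypothesis.Theses.LeeYang
import Summits.RiemannHypothesis.RiemannHypothesis.Theorems.LeeYangLeeyangGhsFaceXiHadamard
import Summits.RiemannHypothesis.RiemannHypothesis.Theorems.LeeYangLeeyangGhsFaceXiEuler
import Literature.Analysis.Complex.KoebeDistortion

/-!
# RiemannHypothesis / LeeYang — the support item `LeeyangGhsFaceXi` (GHS face of the thesis)

Route `RiemannHypothesis/LeeYang`, item stmt-RiemannHypothesis-0454 (`LeeyangGhsFaceXi`, support,
rank 3):

  `ConcaveOn ℝ (Set.Ici (1/2)) (deriv (fun σ : ℝ => Real.log ‖ξ(σ)‖))`,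

i.e. `(log ξ)'` is concave on `[1/2, ∞)` — the one-site GHS inequality for the Pólya–de Bruijn
law `Φ du` read on the `ξ` side (`4∫e^{hu}Φ = ξ(1/2 + h/2)`), a necessary condition for the
route's thesis X (Newman 1991; Ellis–Monroe–Newman 1976).

**Proof (unconditional, no numerics beyond the tree's kernel certificates `N(14) = 0` and RH up to
height `101`).** `D(σ) := Re ξ'/ξ(σ)` is the derivative of `log‖ξ(σ)‖` (`ξ(σ) ≠ 0` on `ℝ`).
* On `[1/2, 24]` (file `…GhsFaceXiHadamard`): by the Hadamard product,
  `D(σ) = Σₙ Re[1/(σ−ρₙ) + 1/(σ−(1−ρₙ))]`; each pair term `u(σ−β)+u(σ−(1−β))`,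
  `u(a) = a/(a²+γ²)`, is concave there because `u'' = 2a(a²−3γ²)/(a²+γ²)³` and either `β = 1/2`,
  `0 ≤ a ≤ 23.5 < √3·14 < √3|γ|`, or `|γ| > 101` and `g = u''/2` is odd and decreasing on
  `[−24, 24]` with `a₁ + a₂ = 2σ − 1 ≥ 0`.
* On `[10, ∞)` (file `…GhsFaceXiEuler`): `D = [1/(σ−1) − Σ_{k=1}^{5} 1/(σ+2k)] + const +
  ½Σ_{k≥6}(1/(k+1) − 2/(σ+2k)) − ΣΛ(n)n^{−σ}`, a sum of concave functions.
* Glue: `D` is differentiable, so `D'` is antitone on both pieces (`ConcaveOn.antitoneOn_deriv`),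
  hence on `[1/2, ∞)`, and `AntitoneOn.concaveOn_of_deriv` concludes.

References: C. M. Newman, Constr. Approx. 7 (1991) 389–399; R. S. Ellis, J. L. Monroe,
C. M. Newman, Comm. Math. Phys. 46 (1976) 167–182, Thm. 1.1–1.2; H. Davenport,
*Multiplicative Number Theory*, Ch. 12 (Hadamard product).
-/

noncomputable section

open Complex Set Literature.NumberTheory.LFunctions

-- D-0017: single-problem summit ⇒ namespace `Summit.RiemannHypothesis.RiemannHypothesis.…` by design
-- (the Summits library sets `weak.linter.dupNamespace = false`; repeated here for stand-alone checks).
set_option linter.dupNamespace false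

namespace Summit.RiemannHypothesis.RiemannHypothesis.Theorems

open Summit.RiemannHypothesis.RiemannHypothesis.Theses.LeeYang

/-- `d/dσ log ‖ξ(σ)‖ = Re ξ'/ξ(σ)` at every real `σ`. [folklore] -/
theorem LeeYangGhs.hasDerivAt_log_norm_riemannXi (σ : ℝ) :
    HasDerivAt (fun x : ℝ => Real.log ‖riemannXi (x : ℂ)‖)
      ((logDeriv riemannXi (σ : ℂ)).re) σ := by
  have hξ := Summit.RiemannHypothesis.LeeYang.riemannXi_ofReal_ne_zero σ
  have hd : HasDerivAt (fun x : ℝ => riemannXi (x : ℂ)) (deriv riemannXi (σ : ℂ)) σ :=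
    (differentiable_riemannXi (σ : ℂ)).hasDerivAt.comp_ofReal
  have := Literature.Analysis.Complex.AreaThm.hasDerivAt_log_norm hd hξ
  rwa [← logDeriv_apply] at this

/-- `deriv log‖ξ‖ = Re ξ'/ξ` on the real axis, as functions. [folklore] -/
theorem LeeYangGhs.deriv_log_norm_riemannXi :
    deriv (fun σ : ℝ => Real.log ‖riemannXi (σ : ℂ)‖) =
      fun σ : ℝ => (logDeriv riemannXi (σ : ℂ)).re :=
  funext fun σ => (LeeYangGhs.hasDerivAt_log_norm_riemannXi σ).deriv

/-- `σ ↦ Re ξ'/ξ(σ)` is differentiable on `ℝ` (`ξ'/ξ` is holomorphic off the zeros of `ξ`).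
[folklore] -/
theorem LeeYangGhs.differentiableAt_re_logDeriv (σ : ℝ) :
    DifferentiableAt ℝ (fun x : ℝ => (logDeriv riemannXi (x : ℂ)).re) σ := by
  have hξ := Summit.RiemannHypothesis.LeeYang.riemannXi_ofReal_ne_zero σ
  have h1 : DifferentiableAt ℂ (deriv riemannXi) (σ : ℂ) :=
    ((differentiable_riemannXi.analyticAt (σ : ℂ)).deriv).differentiableAt
  have hdiff : DifferentiableAt ℂ (logDeriv riemannXi) (σ : ℂ) := by
    have e : logDeriv riemannXi = fun s => deriv riemannXi s / riemannXi s :=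
      funext fun s => logDeriv_apply riemannXi s
    rw [e]
    exact h1.div (differentiable_riemannXi _) hξ
  have hc : HasDerivAt (fun x : ℝ => logDeriv riemannXi (x : ℂ))
      (deriv (logDeriv riemannXi) (σ : ℂ)) σ := hdiff.hasDerivAt.comp_ofReal
  have hre : HasDerivAt (fun x : ℝ => (logDeriv riemannXi (x : ℂ)).re)
      ((deriv (logDeriv riemannXi) (σ : ℂ))).re σ := by
    rw [show (fun x : ℝ => (logDeriv riemannXi (x : ℂ)).re) =
      Complex.reCLM ∘ (fun x : ℝ => logDeriv riemannXi (x : ℂ)) from rfl]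
    exact (Complex.reCLM.hasFDerivAt.comp_hasDerivAt σ hc).congr_deriv (by simp)
  exact hre.differentiableAt

/-- **Item `LeeyangGhsFaceXi` (stmt-RiemannHypothesis-0454).** `(log ξ)'` is concave on
`[1/2, ∞)`: `deriv (σ ↦ log ‖ξ(σ)‖)` is `ConcaveOn ℝ (Ici (1/2))`. Unconditional: Hadamard
product of `ξ` + `N(14) = 0` + RH up to height `101` on `[1/2, 24]`, the explicit formula
`ξ'/ξ = 1/s + 1/(s−1) − (log π)/2 + ½ψ(s/2) − ΣΛ(n)n^{−s}` with the digamma series on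
`[10, ∞)`, glued through the antitone derivative.
[cite: Newman1991, Theorem 1 (the GHS face of Φ); EllisMonroeNewman1976, Thm. 1.1] -/
theorem leeyangGhsFaceXi_proof : LeeyangGhsFaceXi := by
  unfold LeeyangGhsFaceXi
  rw [LeeYangGhs.deriv_log_norm_riemannXi]
  have hdiff : ∀ x : ℝ, DifferentiableAt ℝ (fun x : ℝ => (logDeriv riemannXi (x : ℂ)).re) x :=
    LeeYangGhs.differentiableAt_re_logDeriv
  set D : ℝ → ℝ := fun σ => (logDeriv riemannXi (σ : ℂ)).re with hD
  have h1 : AntitoneOn (deriv D) (Icc (1 / 2 : ℝ) 24) :=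
    LeeYangGhs.concaveOn_re_logDeriv_riemannXi_Icc.antitoneOn_deriv (fun x _ => hdiff x)
  have h2 : AntitoneOn (deriv D) (Ici (10 : ℝ)) :=
    LeeYangGhs.concaveOn_re_logDeriv_riemannXi_Ici.antitoneOn_deriv (fun x _ => hdiff x)
  have h3 : AntitoneOn (deriv D) (Ici (1 / 2 : ℝ)) := by
    intro x hx y hy hxy
    have hx' : (1 / 2 : ℝ) ≤ x := hx
    by_cases hy24 : y ≤ 24
    · exact h1 ⟨hx', hxy.trans hy24⟩ ⟨le_trans hx' hxy, hy24⟩ hxy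
    · push Not at hy24
      by_cases hx10 : 10 ≤ x
      · exact h2 (show (10 : ℝ) ≤ x from hx10) (show (10 : ℝ) ≤ y by linarith) hxy
      · push Not at hx10
        calc deriv D y ≤ deriv D 24 :=
              h2 (show (10 : ℝ) ≤ 24 by norm_num) (show (10 : ℝ) ≤ y by linarith) hy24.le
          _ ≤ deriv D x := h1 ⟨hx', by linarith⟩ ⟨by norm_num, le_refl _⟩ (by linarith)
  exact AntitoneOn.concaveOn_of_deriv (convex_Ici _)
    (fun x _ => (hdiff x).continuousAt.continuousWithinAt)
    (fun x _ => (hdiff x).differentiableWithinAt) (h3.mono interior_subset)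

end Summit.RiemannHypothesis.RiemannHypothesis.Theorems
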